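import Mathlib

/-!
# Order-preserving partial injections: `|ℐ𝒪ₙ| = (2n choose n)`

[Ganyushkin–Mazorchuk 2009, §14.1 and Proposition 14.2.4, Corollary 14.2.5].  `ℐ𝒪ₙ = 𝒫𝒪ₙ ∩ ℐ𝒮ₙ`
is the semigroup of order-preserving partial injections of the chain `{1 < ⋯ < n}`.  As in
`PartialTransformations`, a partial transformation of `Fin n` is a function
`α : Fin n → Option (Fin n)` (`none` = undefined), `dom α = {x | (α x).isSome}`,
`im α = {y | ∃ x, α x = some y}`; `α` is a partial injection if `α x₁ = α x₂ = some y` forces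
`x₁ = x₂`, and order-preserving if `x₁ ≤ x₂`, `α x₁ = some y₁`, `α x₂ = some y₂` imply `y₁ ≤ y₂`.

* §14.1: an element of `ℐ𝒪ₙ` is the unique increasing bijection `dom α → im α`, so it is
  determined by `dom α` and `im α` (`eq_of_dom_eq_of_im_eq`), and any two subsets of the same
  size occur (`exists_dom_eq_im_eq`);
* Proposition 14.2.4: `|ℐ𝒪ₙ| = ∑ₖ (n choose k)² = (2n choose n)` (`card_orderPreservingPartialInjection`);
* Corollary 14.2.5: `|ℐ𝒪ₙ| = 2 |𝒪ₙ|`, i.e. `= 2 (2n-1 choose n)` for `n ≥ 1` (cf. Proposition 14.2.3,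
  `OrderPreserving.card_monotone`) (`card_orderPreservingPartialInjection_eq_two_mul`).

## References
* [GanyushkinMazorchuk2009] O. Ganyushkin, V. Mazorchuk, *Classical Finite Transformation
  Semigroups. An Introduction*, Algebra and Applications 9, Springer, 2009, §14.1–14.2.
-/

namespace Literature.Algebra.Semigroups.OrderPreserving

open Function Set

variable {n : ℕ}

/-- The increasing enumeration of the domain composed with `α ∈ ℐ𝒪ₙ` is strictly increasing with
range `im α`. [folklore] -/
private theorem strictMono_enum {α : Fin n → Option (Fin n)}
    (hi : ∀ x₁ x₂ y, α x₁ = some y → α x₂ = some y → x₁ = x₂)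
    (ho : ∀ x₁ x₂ y₁ y₂, x₁ ≤ x₂ → α x₁ = some y₁ → α x₂ = some y₂ → y₁ ≤ y₂)
    (A : Finset (Fin n)) (hA : ∀ x, x ∈ A ↔ (α x).isSome) :
    ∃ g : Fin A.card → Fin n, StrictMono g ∧ (∀ i, α (A.orderEmbOfFin rfl i) = some (g i)) ∧
      range g = {y | ∃ x, α x = some y} := by
  have hdef : ∀ i, (α (A.orderEmbOfFin rfl i)).isSome := fun i =>
    (hA _).1 (A.orderEmbOfFin_mem rfl i)
  refine ⟨fun i => (α (A.orderEmbOfFin rfl i)).get (hdef i), ?_,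
    fun i => (Option.some_get (hdef i)).symm, ?_⟩
  · intro i j hij
    show (α (A.orderEmbOfFin rfl i)).get (hdef i) < (α (A.orderEmbOfFin rfl j)).get (hdef j)
    have hle := (A.orderEmbOfFin rfl).monotone hij.le
    have h1 := (Option.some_get (hdef i)).symm
    have h2 := (Option.some_get (hdef j)).symm
    refine lt_of_le_of_ne (ho _ _ _ _ hle h1 h2) fun heq => ?_
    rw [heq] at h1
    exact absurd ((A.orderEmbOfFin rfl).injective (hi _ _ _ h1 h2)) hij.ne
  · ext y
    constructor
    · rintro ⟨i, rfl⟩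
      exact ⟨_, (Option.some_get (hdef i)).symm⟩
    · rintro ⟨x, hx⟩
      have hxA : x ∈ (A : Set (Fin n)) := by
        rw [Finset.mem_coe, hA, hx]; rfl
      rw [← Finset.range_orderEmbOfFin A rfl] at hxA
      obtain ⟨i, rfl⟩ := hxA
      exact ⟨i, by simp [hx]⟩

/-- §14.1 (the paragraph before Proposition 14.1.6): `α ∈ ℐ𝒪ₙ` is the unique increasing
bijection from `dom α` onto `im α`; in particular `α` is uniquely determined by `dom α` and
`im α`. [cite: GanyushkinMazorchuk2009, §14.1] -/
theorem eq_of_dom_eq_of_im_eq {α β : Fin n → Option (Fin n)}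
    (hαi : ∀ x₁ x₂ y, α x₁ = some y → α x₂ = some y → x₁ = x₂)
    (hαo : ∀ x₁ x₂ y₁ y₂, x₁ ≤ x₂ → α x₁ = some y₁ → α x₂ = some y₂ → y₁ ≤ y₂)
    (hβi : ∀ x₁ x₂ y, β x₁ = some y → β x₂ = some y → x₁ = x₂)
    (hβo : ∀ x₁ x₂ y₁ y₂, x₁ ≤ x₂ → β x₁ = some y₁ → β x₂ = some y₂ → y₁ ≤ y₂)
    (hdom : ∀ x, (α x).isSome ↔ (β x).isSome)
    (him : ∀ y, (∃ x, α x = some y) ↔ ∃ x, β x = some y) : α = β := by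
  classical
  let A : Finset (Fin n) := Finset.univ.filter fun x => (α x).isSome
  have hA : ∀ x, x ∈ A ↔ (α x).isSome := fun x => by simp [A]
  have hA' : ∀ x, x ∈ A ↔ (β x).isSome := fun x => (hA x).trans (hdom x)
  obtain ⟨gα, hgα, hαg, hrα⟩ := strictMono_enum hαi hαo A hA
  obtain ⟨gβ, hgβ, hβg, hrβ⟩ := strictMono_enum hβi hβo A hA'
  have hg : gα = gβ := by
    rw [← hgα.range_inj hgβ, hrα, hrβ]
    ext y
    exact him y
  funext x
  by_cases hx : x ∈ A
  · have hxA : x ∈ (A : Set (Fin n)) := hx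
    rw [← Finset.range_orderEmbOfFin A rfl] at hxA
    obtain ⟨i, rfl⟩ := hxA
    rw [hαg, hβg, hg]
  · have h1 : α x = none := Option.not_isSome_iff_eq_none.1 (mt (hA x).2 hx)
    have h2 : β x = none := Option.not_isSome_iff_eq_none.1 (mt (hA' x).2 hx)
    rw [h1, h2]

/-- §14.1 / proof of Proposition 14.2.4: for subsets `A, B` of the same cardinality there is an
element of `ℐ𝒪ₙ` with domain `A` and image `B` (the increasing bijection `A → B`).
[cite: GanyushkinMazorchuk2009, Proposition 14.2.4 (proof)] -/
theorem exists_dom_eq_im_eq (A B : Finset (Fin n)) (h : A.card = B.card) :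
    ∃ α : Fin n → Option (Fin n), (∀ x₁ x₂ y, α x₁ = some y → α x₂ = some y → x₁ = x₂) ∧
      (∀ x₁ x₂ y₁ y₂, x₁ ≤ x₂ → α x₁ = some y₁ → α x₂ = some y₂ → y₁ ≤ y₂) ∧
      (∀ x, (α x).isSome ↔ x ∈ A) ∧ ∀ y, (∃ x, α x = some y) ↔ y ∈ B := by
  classical
  let eA := A.orderIsoOfFin rfl
  let eB := B.orderEmbOfFin h.symm
  refine ⟨fun x => if hx : x ∈ A then some (eB (eA.symm ⟨x, hx⟩)) else none, ?_, ?_, ?_, ?_⟩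
  · intro x₁ x₂ y h1 h2
    dsimp only at h1 h2
    by_cases hx₁ : x₁ ∈ A
    · by_cases hx₂ : x₂ ∈ A
      · rw [dif_pos hx₁] at h1
        rw [dif_pos hx₂] at h2
        have := eB.injective ((Option.some_inj.1 h1).trans (Option.some_inj.1 h2).symm)
        have := eA.symm.injective this
        exact congrArg Subtype.val this
      · rw [dif_neg hx₂] at h2; exact absurd h2 (by simp)
    · rw [dif_neg hx₁] at h1; exact absurd h1 (by simp)
  · intro x₁ x₂ y₁ y₂ hle h1 h2
    dsimp only at h1 h2
    by_cases hx₁ : x₁ ∈ A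
    · by_cases hx₂ : x₂ ∈ A
      · rw [dif_pos hx₁, Option.some_inj] at h1
        rw [dif_pos hx₂, Option.some_inj] at h2
        rw [← h1, ← h2]
        exact eB.monotone (eA.symm.monotone hle)
      · rw [dif_neg hx₂] at h2; exact absurd h2 (by simp)
    · rw [dif_neg hx₁] at h1; exact absurd h1 (by simp)
  · intro x
    by_cases hx : x ∈ A
    · simp [hx]
    · simp [hx]
  · intro y
    constructor
    · rintro ⟨x, hx⟩
      dsimp only at hx
      by_cases hxA : x ∈ A
      · rw [dif_pos hxA, Option.some_inj] at hx
        rw [← hx]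
        exact B.orderEmbOfFin_mem h.symm _
      · rw [dif_neg hxA] at hx; exact absurd hx (by simp)
    · intro hy
      have hyB : y ∈ (B : Set (Fin n)) := hy
      rw [← Finset.range_orderEmbOfFin B h.symm] at hyB
      obtain ⟨j, rfl⟩ := hyB
      refine ⟨(eA j : Fin n), ?_⟩
      dsimp only
      rw [dif_pos (eA j).2, Subtype.coe_eta, OrderIso.symm_apply_apply]

/-- Proposition 14.2.4: `|ℐ𝒪ₙ| = ∑ₖ (n choose k)² = (2n choose n)` — an element of `ℐ𝒪ₙ` is the
same as a pair `(dom, im)` of subsets of equal size. [cite: GanyushkinMazorchuk2009, Proposition 14.2.4] -/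
theorem card_orderPreservingPartialInjection (n : ℕ) :
    Fintype.card {α : Fin n → Option (Fin n) //
      (∀ x₁ x₂ y, α x₁ = some y → α x₂ = some y → x₁ = x₂) ∧
      (∀ x₁ x₂ y₁ y₂, x₁ ≤ x₂ → α x₁ = some y₁ → α x₂ = some y₂ → y₁ ≤ y₂)} =
      (2 * n).choose n := by
  classical
  -- `α ↦ (dom α, im α)` is a bijection onto the pairs of subsets of equal size
  let Φ : {α : Fin n → Option (Fin n) //
      (∀ x₁ x₂ y, α x₁ = some y → α x₂ = some y → x₁ = x₂) ∧
      (∀ x₁ x₂ y₁ y₂, x₁ ≤ x₂ → α x₁ = some y₁ → α x₂ = some y₂ → y₁ ≤ y₂)} →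
      {p : Finset (Fin n) × Finset (Fin n) // p.1.card = p.2.card} := fun α =>
    ⟨(Finset.univ.filter fun x => (α.1 x).isSome,
      Finset.univ.filter fun y => ∃ x, α.1 x = some y), by
      obtain ⟨g, hg, hαg, hr⟩ := strictMono_enum α.2.1 α.2.2
        (Finset.univ.filter fun x => (α.1 x).isSome) (fun x => by simp)
      dsimp only
      have : (Finset.univ.filter fun y => ∃ x, α.1 x = some y) = Finset.univ.image g := by
        apply Finset.coe_injective
        rw [Finset.coe_image, Finset.coe_univ, image_univ, hr, Finset.coe_filter]
        simp
      rw [this, Finset.card_image_of_injective _ hg.injective, Finset.card_univ,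
        Fintype.card_fin]⟩
  have hΦ : Bijective Φ := by
    constructor
    · rintro ⟨α, hαi, hαo⟩ ⟨β, hβi, hβo⟩ h
      apply Subtype.ext
      simp only [Φ, Subtype.mk.injEq, Prod.mk.injEq] at h
      obtain ⟨h1, h2⟩ := h
      refine eq_of_dom_eq_of_im_eq hαi hαo hβi hβo (fun x => ?_) (fun y => ?_)
      · have := Finset.ext_iff.1 h1 x
        simpa using this
      · have := Finset.ext_iff.1 h2 y
        simpa using this
    · rintro ⟨⟨A, B⟩, hAB⟩
      obtain ⟨α, hi, ho, hd, him⟩ := exists_dom_eq_im_eq A B hAB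
      refine ⟨⟨α, hi, ho⟩, Subtype.ext (Prod.ext ?_ ?_)⟩
      · ext x; simp [Φ, hd]
      · ext y; simp [Φ, him]
  rw [Fintype.card_of_bijective hΦ, Fintype.card_congr (Equiv.subtypeProdEquivSigmaSubtype
    fun (A B : Finset (Fin n)) => A.card = B.card), Fintype.card_sigma]
  simp_rw [fun A : Finset (Fin n) => show Fintype.card {B : Finset (Fin n) // A.card = B.card} =
    n.choose A.card by
      rw [Fintype.card_congr (Equiv.subtypeEquivRight fun B => eq_comm), Fintype.card_finset_len,
        Fintype.card_fin]]
  have h2 := Finset.sum_powerset_apply_card (fun k => n.choose k) (x := (Finset.univ : Finset (Fin n)))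
  simp only [Finset.powerset_univ, Finset.card_univ, Fintype.card_fin, smul_eq_mul] at h2
  rw [h2, ← Nat.sum_range_choose_sq]
  exact Finset.sum_congr rfl fun k _ => (sq _).symm

/-- `(2n choose n) = 2 (2n-1 choose n)` for `n ≥ 1`. [folklore] -/
private theorem choose_two_mul_eq (n : ℕ) (hn : 1 ≤ n) :
    (2 * n).choose n = 2 * (2 * n - 1).choose n := by
  obtain ⟨m, rfl⟩ := Nat.exists_eq_add_of_le hn
  have h1 : 2 * (1 + m) = (2 * m + 1) + 1 := by ring
  have h2 : 2 * (1 + m) - 1 = 2 * m + 1 := by omega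
  rw [h2, h1, show 1 + m = m + 1 from add_comm 1 m, Nat.choose_succ_succ, Nat.choose_symm_half]
  omega

/-- Corollary 14.2.5: `|ℐ𝒪ₙ| = 2|𝒪ₙ|` (`n ≥ 1`); with Proposition 14.2.3 (`|𝒪ₙ| = (2n-1 choose n)`,
`OrderPreserving.card_monotone`) this reads `|ℐ𝒪ₙ| = 2 (2n-1 choose n)`.
[cite: GanyushkinMazorchuk2009, Corollary 14.2.5] -/
theorem card_orderPreservingPartialInjection_eq_two_mul (n : ℕ) (hn : 1 ≤ n) :
    Fintype.card {α : Fin n → Option (Fin n) //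
      (∀ x₁ x₂ y, α x₁ = some y → α x₂ = some y → x₁ = x₂) ∧
      (∀ x₁ x₂ y₁ y₂, x₁ ≤ x₂ → α x₁ = some y₁ → α x₂ = some y₂ → y₁ ≤ y₂)} =
      2 * (2 * n - 1).choose n := by
  rw [card_orderPreservingPartialInjection, choose_two_mul_eq n hn]

end Literature.Algebra.Semigroups.OrderPreserving
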